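import Summits.KontsevichZagierPeriods.KontsevichZagierPeriods.Theorems.EffectiveXMapChains.Negative.CountedTransfer
import Literature.NumberTheory.EllipticCurves.RealPeriod

/-!
# `EffectiveXMapChains` (stmt-KontsevichZagierPeriods-10664) — negative knowledge, part 2: the period representations, values, load-bearing hypotheses

Support file for the crux `IsogenyCertificates.EffectiveXMapChains` (cdisprove seat; part 1 is
`Negative/CountedTransfer.lean`). §3 NON-VACUITY: the representations the crux quantifies over EXIST —
`periodRep A B a h : KZ.IntegralRep 1 = [{x³+Ax+B > 0}, a/√(x³+Ax+B)]` (domain and graph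
`ℚ`-semialgebraic by hand; integrability from the tree's
`WeierstrassCurve.integrableOn_inv_sqrt_twoTorsionPolynomial'`, `ψ = 4P`), with
`value = a · Ω(E)`, `Ω = WeierstrassCurve.realPeriod ⟨0,0,0,A,B⟩ = ∫_{P>0} dx/√P > 0`
(`periodRep_value`, `value_eq_of_isPeriodRep`, `value_eq_iff`: value equality pins `b/a`).
§4 LOAD-BEARING analysis of the conclusion's inner hypotheses: value equality is necessary for
EVERY bound (`not_chainBound_without_valueEq`, witness the identity datum on `y² = x³ − x`, `a = 1`,
`b = 2`, by soundness of the calculus and `Ω > 0`); positivity of the scalars is decorative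
(`chain_of_scalar_zero`: `a = 0` forces `b = 0` and a chain of length `2`).

References: Kontsevich–Zagier, *Periods* (2001), §§1.1–1.2; Cremona, *Algorithms for Modular
Elliptic Curves* (1997), §3.7; Silverman, *The Arithmetic of Elliptic Curves* (2009), III.4.5.
-/

noncomputable section

namespace Summit.KontsevichZagierPeriods.IsogenyCertificates.EffectiveXMapChainsNegative

open Polynomial Set MeasureTheory
open Literature.NumberTheory.Transcendental
open Summit.KontsevichZagierPeriods.KontsevichZagierPeriods.Theses.IsogenyCertificates
/-! ## §3 The period representations `[{P>0}, a/√P]` exist (non-vacuity) and their values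

The crux quantifies over `r r' : KZ.IntegralRep 1` with prescribed domain and integrand-on-domain.
We construct them (semialgebraicity by hand, integrability from the tree's
`WeierstrassCurve.integrableOn_inv_sqrt_twoTorsionPolynomial'`, `ψ = 4P`), and compute
`value = a · Ω(E_{A,B})` with `Ω = WeierstrassCurve.realPeriod ⟨0,0,0,A,B⟩ = ∫_{P>0} dx/√P > 0`.
-/

/-- The short Weierstrass model `y² = x³ + Ax + B` over `ℝ`. [folklore] -/
def curve (A B : ℤ) : WeierstrassCurve ℝ := ⟨0, 0, 0, (A : ℝ), (B : ℝ)⟩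

/-- The 2-torsion polynomial of `y² = x³ + Ax + B` is `ψ = 4(x³ + Ax + B)`. [folklore] -/
lemma curve_ψ (A B : ℤ) (t : ℝ) :
    (curve A B).twoTorsionPolynomial.toPoly.eval t = 4 * (t ^ 3 + (A : ℝ) * t + (B : ℝ)) := by
  simp only [curve, WeierstrassCurve.twoTorsionPolynomial, Cubic.toPoly, WeierstrassCurve.b₂,
    WeierstrassCurve.b₄, WeierstrassCurve.b₆, eval_add, eval_mul, eval_C, eval_pow, eval_X]
  ring

/-- The discriminant of `y² = x³ + Ax + B` is `−16(4A³ + 27B²)`. [folklore] -/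
lemma curve_Δ (A B : ℤ) : (curve A B).Δ = -16 * (4 * (A : ℝ) ^ 3 + 27 * (B : ℝ) ^ 2) := by
  simp only [curve, WeierstrassCurve.Δ, WeierstrassCurve.b₂, WeierstrassCurve.b₄,
    WeierstrassCurve.b₆, WeierstrassCurve.b₈]
  ring

/-- `4A³ + 27B² ≠ 0` makes `y² = x³ + Ax + B` an elliptic curve over `ℝ`. [folklore] -/
lemma curve_isElliptic {A B : ℤ} (h : 4 * A ^ 3 + 27 * B ^ 2 ≠ 0) : (curve A B).IsElliptic := by
  rw [WeierstrassCurve.isElliptic_iff, curve_Δ, isUnit_iff_ne_zero]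
  refine mul_ne_zero (by norm_num) ?_
  exact_mod_cast h

/-- The 2-torsion set `{ψ > 0}` of `y² = x³ + Ax + B` is `{x³ + Ax + B > 0}`. [folklore] -/
lemma curve_twoTorsionSet (A B : ℤ) :
    (curve A B).twoTorsionSet = {t | 0 < t ^ 3 + (A : ℝ) * t + (B : ℝ)} := by
  ext t
  rw [WeierstrassCurve.mem_twoTorsionSet_iff, curve_ψ, mem_setOf_eq]
  exact mul_pos_iff_of_pos_left (by norm_num)

/-- `√(4u) = 2√u`. [folklore] -/
lemma sqrt_four_mul (u : ℝ) : Real.sqrt (4 * u) = 2 * Real.sqrt u := by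
  rw [Real.sqrt_mul (by norm_num : (0 : ℝ) ≤ 4)]
  congr 1
  rw [show (4 : ℝ) = 2 ^ 2 by norm_num]
  exact Real.sqrt_sq (by norm_num)

/-- `a/√P = 2a·(√ψ)⁻¹` with `ψ = 4P` (also at the junk value `√P = 0`). [folklore] -/
lemma div_sqrt_eq (a t : ℝ) (A B : ℤ) :
    a / Real.sqrt (t ^ 3 + (A : ℝ) * t + (B : ℝ)) =
      2 * a * (Real.sqrt ((curve A B).twoTorsionPolynomial.toPoly.eval t))⁻¹ := by
  rw [curve_ψ, sqrt_four_mul]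
  by_cases hu : Real.sqrt (t ^ 3 + (A : ℝ) * t + (B : ℝ)) = 0
  · simp [hu]
  · field_simp

/-- Integrability of `a/√P` on `{P > 0} ⊆ ℝ` (from the tree's real-period file). [cite: CremonaAlgorithms1997, §3.7] -/
lemma integrableOn_real {A B : ℤ} (h : 4 * A ^ 3 + 27 * B ^ 2 ≠ 0) (a : ℝ) :
    IntegrableOn (fun t : ℝ => a / Real.sqrt (t ^ 3 + (A : ℝ) * t + (B : ℝ)))
      {t | 0 < t ^ 3 + (A : ℝ) * t + (B : ℝ)} := by
  haveI := curve_isElliptic h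
  have hint := (curve A B).integrableOn_inv_sqrt_twoTorsionPolynomial'
  rw [curve_twoTorsionSet] at hint
  have heq : (fun t : ℝ => a / Real.sqrt (t ^ 3 + (A : ℝ) * t + (B : ℝ))) =
      fun t => 2 * a * (Real.sqrt ((curve A B).twoTorsionPolynomial.toPoly.eval t))⁻¹ := by
    funext t; exact div_sqrt_eq a t A B
  rw [heq]
  exact hint.const_mul (2 * a)

/-- The same on `ℝ¹ = Fin 1 → ℝ` (transport along `MeasurableEquiv.funUnique`). [cite: CremonaAlgorithms1997, §3.7] -/
lemma integrableOn_rep {A B : ℤ} (h : 4 * A ^ 3 + 27 * B ^ 2 ≠ 0) (a : ℝ) :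
    IntegrableOn (fun x : Fin 1 → ℝ => a / Real.sqrt (x 0 ^ 3 + (A : ℝ) * x 0 + (B : ℝ)))
      {x | 0 < x 0 ^ 3 + (A : ℝ) * x 0 + (B : ℝ)} := by
  have he := MeasureTheory.volume_preserving_funUnique (Fin 1) ℝ
  exact (he.integrableOn_comp_preimage (MeasurableEquiv.measurableEmbedding _)).mpr
    (integrableOn_real h a)

/-- `X₀³ + A X₀ + B` as a `ℚ`-polynomial in the variables `Fin n`. [folklore] -/
def cubicMv (n : ℕ) (i : Fin n) (A B : ℤ) : MvPolynomial (Fin n) ℚ :=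
  MvPolynomial.X i ^ 3 + MvPolynomial.C (A : ℚ) * MvPolynomial.X i + MvPolynomial.C (B : ℚ)

/-- Evaluation of `cubicMv`. [folklore] -/
lemma aeval_cubicMv {n : ℕ} (i : Fin n) (A B : ℤ) (x : Fin n → ℝ) :
    MvPolynomial.aeval x (cubicMv n i A B) = x i ^ 3 + (A : ℝ) * x i + (B : ℝ) := by
  simp [cubicMv]

/-- The domain `{x | 0 < x₀³ + A x₀ + B} ⊆ ℝ¹` is `ℚ`-semialgebraic. [folklore] -/
lemma isSemialgebraic_domain (A B : ℤ) :
    Literature.ModelTheory.ExponentialFields.IsSemialgebraic ℚ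
      {x : Fin 1 → ℝ | 0 < x 0 ^ 3 + (A : ℝ) * x 0 + (B : ℝ)} := by
  simpa [aeval_cubicMv] using
    Literature.ModelTheory.ExponentialFields.isSemialgebraic_setOf_eval_pos (k := ℚ) (R := ℝ)
      (cubicMv 1 0 A B)

/-- `y = a/√P ↔ y²P = a² ∧ a·y ≥ 0` for `P > 0` (semialgebraic description of the graph). [folklore] -/
lemma eq_div_sqrt_iff {P y a : ℝ} (hP : 0 < P) :
    y = a / Real.sqrt P ↔ y ^ 2 * P - a ^ 2 = 0 ∧ 0 ≤ a * y := by
  have hs : 0 < Real.sqrt P := Real.sqrt_pos.mpr hP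
  have hsq : Real.sqrt P ^ 2 = P := Real.sq_sqrt hP.le
  constructor
  · rintro rfl
    refine ⟨?_, ?_⟩
    · rw [div_pow, hsq, div_mul_cancel₀ _ hP.ne', sub_self]
    · have : a * (a / Real.sqrt P) = a ^ 2 / Real.sqrt P := by ring
      rw [this]; positivity
  · rintro ⟨h1, h2⟩
    have h3 : (y * Real.sqrt P) ^ 2 = a ^ 2 := by rw [mul_pow, hsq]; linarith
    rw [eq_div_iff hs.ne']
    rcases sq_eq_sq_iff_eq_or_eq_neg.mp h3 with h4 | h4
    · exact h4
    · have h5 : a = 0 := by nlinarith [mul_nonneg h2 hs.le, sq_nonneg a]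
      subst h5; simpa using h4

/-- The integrand `a/√(x₀³ + A x₀ + B)` is a `ℚ`-semialgebraic function on `{P > 0}`: its graph is `{P(z₀) > 0, z₁²P(z₀) = a², a z₁ ≥ 0}`. [folklore] -/
lemma isSemialgebraicFunOn_integrand (A B : ℤ) (a : ℚ) :
    IsSemialgebraicFunOn ℚ {x : Fin 1 → ℝ | 0 < x 0 ^ 3 + (A : ℝ) * x 0 + (B : ℝ)}
      (fun x => (a : ℝ) / Real.sqrt (x 0 ^ 3 + (A : ℝ) * x 0 + (B : ℝ))) := by
  rw [isSemialgebraicFunOn_iff]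
  have h1 := Literature.ModelTheory.ExponentialFields.isSemialgebraic_setOf_eval_pos (k := ℚ)
    (R := ℝ) (cubicMv 2 0 A B)
  have h2 := Literature.ModelTheory.ExponentialFields.isSemialgebraic_setOf_eval_eq_zero (k := ℚ)
    (R := ℝ) (MvPolynomial.X 1 ^ 2 * cubicMv 2 0 A B - MvPolynomial.C (a ^ 2 : ℚ))
  have h3 := Literature.ModelTheory.ExponentialFields.isSemialgebraic_setOf_eval_nonneg (k := ℚ)
    (R := ℝ) (MvPolynomial.C (a : ℚ) * MvPolynomial.X (1 : Fin 2))
  convert h1.inter (h2.inter h3) using 1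
  ext z
  simp only [mem_setOf_eq, mem_inter_iff, map_sub, map_mul, map_pow, MvPolynomial.aeval_X,
    MvPolynomial.aeval_C, aeval_cubicMv, eq_ratCast]
  have e0 : Fin.init z 0 = z 0 := rfl
  have e1 : z (Fin.last 1) = z 1 := rfl
  rw [e0, e1]
  constructor
  · rintro ⟨hP, hy⟩
    exact ⟨hP, (eq_div_sqrt_iff hP).mp hy⟩
  · rintro ⟨hP, hy⟩
    exact ⟨hP, (eq_div_sqrt_iff hP).mpr hy⟩

/-- **The period representation** `[{x³+Ax+B > 0}, a/√(x³+Ax+B)]` as a KZ integral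
representation (dimension 1). [cite: KontsevichZagier2001, §1.1] -/
def periodRep (A B : ℤ) (a : ℚ) (h : 4 * A ^ 3 + 27 * B ^ 2 ≠ 0) : KZ.IntegralRep 1 where
  domain := {x | 0 < x 0 ^ 3 + (A : ℝ) * x 0 + (B : ℝ)}
  integrand := fun x => (a : ℝ) / Real.sqrt (x 0 ^ 3 + (A : ℝ) * x 0 + (B : ℝ))
  isSemialgebraic_domain := isSemialgebraic_domain A B
  isSemialgebraicFunOn_integrand := isSemialgebraicFunOn_integrand A B a
  integrableOn := integrableOn_rep h a

/-- The domain of `periodRep`. [folklore] -/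
@[simp] lemma periodRep_domain (A B : ℤ) (a : ℚ) (h : 4 * A ^ 3 + 27 * B ^ 2 ≠ 0) :
    (periodRep A B a h).domain = {x | 0 < x 0 ^ 3 + (A : ℝ) * x 0 + (B : ℝ)} := rfl

/-- The integrand of `periodRep`. [folklore] -/
@[simp] lemma periodRep_integrand (A B : ℤ) (a : ℚ) (h : 4 * A ^ 3 + 27 * B ^ 2 ≠ 0) :
    (periodRep A B a h).integrand = fun x => (a : ℝ) / Real.sqrt (x 0 ^ 3 + (A : ℝ) * x 0 + (B : ℝ)) :=
  rfl

/-- `∫_{x ∈ ℝ¹, P(x₀) > 0} a/√P(x₀) = a · Ω(E_{A,B})`. [cite: CremonaAlgorithms1997, §3.7] -/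
lemma setIntegral_rep (A B : ℤ) (a : ℝ) :
    ∫ x in {x : Fin 1 → ℝ | 0 < x 0 ^ 3 + (A : ℝ) * x 0 + (B : ℝ)},
        a / Real.sqrt (x 0 ^ 3 + (A : ℝ) * x 0 + (B : ℝ)) = a * (curve A B).realPeriod := by
  have he := MeasureTheory.volume_preserving_funUnique (Fin 1) ℝ
  have h1 := he.setIntegral_preimage_emb (MeasurableEquiv.measurableEmbedding _)
    (fun t : ℝ => a / Real.sqrt (t ^ 3 + (A : ℝ) * t + (B : ℝ)))
    {t | 0 < t ^ 3 + (A : ℝ) * t + (B : ℝ)}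
  refine h1.trans ?_
  have hmeas : MeasurableSet {t : ℝ | 0 < t ^ 3 + (A : ℝ) * t + (B : ℝ)} := by
    rw [← curve_twoTorsionSet]; exact (curve A B).measurableSet_twoTorsionSet
  rw [setIntegral_congr_fun hmeas (fun t _ => div_sqrt_eq a t A B), integral_const_mul,
    WeierstrassCurve.realPeriod, curve_twoTorsionSet]
  ring

/-- **Value of the period representation**: `a · Ω(E)`, `Ω = ∫_{P>0} dx/√P` (`realPeriod`). [cite: CremonaAlgorithms1997, §3.7] -/
theorem periodRep_value (A B : ℤ) (a : ℚ) (h : 4 * A ^ 3 + 27 * B ^ 2 ≠ 0) :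
    (periodRep A B a h).value = (a : ℝ) * (curve A B).realPeriod :=
  setIntegral_rep A B a

/-- Any representation with the crux's domain and integrand-on-domain has the same value. [folklore] -/
theorem value_eq_of_isPeriodRep {A B : ℤ} {a : ℚ} {r : KZ.IntegralRep 1}
    (h1 : r.domain = {x | 0 < x 0 ^ 3 + (A : ℝ) * x 0 + (B : ℝ)})
    (h2 : EqOn r.integrand (fun x => (a : ℝ) / Real.sqrt (x 0 ^ 3 + (A : ℝ) * x 0 + (B : ℝ)))
      r.domain) :
    r.value = (a : ℝ) * (curve A B).realPeriod := by
  unfold KZ.IntegralRep.value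
  rw [setIntegral_congr_fun (KZ.IntegralRep.measurableSet_domain_holds r) h2, h1]
  exact setIntegral_rep A B a

/-- `Ω(E) > 0` for nonsingular `(A, B)` (from the tree's `realPeriod_pos'`). [folklore] -/
lemma realPeriod_pos {A B : ℤ} (h : 4 * A ^ 3 + 27 * B ^ 2 ≠ 0) : 0 < (curve A B).realPeriod := by
  haveI := curve_isElliptic h
  exact (curve A B).realPeriod_pos'

/-- **Value equality pins the scalar ratio**: `r.value = r'.value ↔ a·Ω(E) = b·Ω(E')`. [folklore] -/
theorem value_eq_iff {A B A' B' : ℤ} {a b : ℚ} {r r' : KZ.IntegralRep 1}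
    (h1 : r.domain = {x | 0 < x 0 ^ 3 + (A : ℝ) * x 0 + (B : ℝ)})
    (h2 : EqOn r.integrand (fun x => (a : ℝ) / Real.sqrt (x 0 ^ 3 + (A : ℝ) * x 0 + (B : ℝ)))
      r.domain)
    (h3 : r'.domain = {x | 0 < x 0 ^ 3 + (A' : ℝ) * x 0 + (B' : ℝ)})
    (h4 : EqOn r'.integrand (fun x => (b : ℝ) / Real.sqrt (x 0 ^ 3 + (A' : ℝ) * x 0 + (B' : ℝ)))
      r'.domain) :
    r.value = r'.value ↔ (a : ℝ) * (curve A B).realPeriod = (b : ℝ) * (curve A' B').realPeriod := by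
  rw [value_eq_of_isPeriodRep h1 h2, value_eq_of_isPeriodRep h3 h4]

/-! ## §4 Load-bearing analysis of the conclusion's inner hypotheses

* `r.value = r'.value` is LOAD-BEARING: without it the conclusion is false for every bound `L`
  (`not_chainBound_without_valueEq`), by soundness of the calculus and `Ω > 0`.
* `0 < a`, `0 < b` are DECORATIVE: the case `a = 0` forces `b = 0` and is joined by a chain of
  length `2` (`chain_of_scalar_zero`); zero-integrand representations are relations in two moves
  (`chain_of_integrand_zero`).
* `4A³+27B² ≠ 0` dropped makes the instance vacuous rather than false (the integrand `1/√P` is then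
  not integrable at the multiple root, so no `r : IntegralRep 1` exists) — recorded, not formalised.
* `∃ datum` dropped = crux #4 territory (`RealPeriodSectorComplete`): not attackable here.
-/

/-- The identity certificate `(f, g, c) = (X, 1, 1)` is a datum from `(A, B)` to itself
(`W = 1`). [folklore] -/
theorem identity_datum (A B : ℤ) :
    derivative (X : ℚ[X]) * 1 - X * derivative 1 ≠ 0 ∧
      C ((1 : ℚ) ^ 2) * 1 * (X ^ 3 + C (A : ℚ) * X * 1 ^ 2 + C (B : ℚ) * 1 ^ 3) =
        (X ^ 3 + C (A : ℚ) * X + C (B : ℚ)) * (derivative (X : ℚ[X]) * 1 - X * derivative 1) ^ 2 := by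
  refine ⟨by simp, ?_⟩
  simp only [derivative_X, derivative_one, mul_one, mul_zero, sub_zero, one_pow, map_one]
  ring

/-- The lemniscate `2`-isogeny datum `(f, g, c) = (X² − 1, X, 1)` from `(−1, 0)` to `(4, 0)`
(calibration; cf. `Literature.NumberTheory.EllipticCurves.hasXMapCertificate_lemniscate`).
[cite: SilvermanAEC2009, Example III.4.5] -/
theorem lemniscate_datum :
    derivative (X ^ 2 - 1 : ℚ[X]) * X - (X ^ 2 - 1) * derivative X ≠ 0 ∧
      C ((1 : ℚ) ^ 2) * X * ((X ^ 2 - 1) ^ 3 + C ((4 : ℤ) : ℚ) * (X ^ 2 - 1) * X ^ 2 +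
          C ((0 : ℤ) : ℚ) * X ^ 3) =
        (X ^ 3 + C ((-1 : ℤ) : ℚ) * X + C ((0 : ℤ) : ℚ)) *
          (derivative (X ^ 2 - 1 : ℚ[X]) * X - (X ^ 2 - 1) * derivative X) ^ 2 := by
  have hw : derivative (X ^ 2 - 1 : ℚ[X]) * X - (X ^ 2 - 1) * derivative X = X ^ 2 + 1 := by
    simp only [derivative_sub, derivative_X_pow, derivative_one, derivative_X, Nat.cast_ofNat,
      map_ofNat, Nat.add_one_sub_one, pow_one]
    ring
  refine ⟨?_, ?_⟩
  · rw [hw]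
    intro h0
    have := congrArg (fun p : ℚ[X] => p.coeff 0) h0
    simp at this
  · rw [hw]
    simp only [Int.cast_neg, Int.cast_one, map_neg, map_one, Int.cast_zero, map_zero,
      Int.cast_ofNat, map_ofNat, one_pow]
    ring

/-- A zero-integrand representation is (minus) ONE integrand-additivity move: `0 = 0 + 0`. [cite: KontsevichZagier2001, §1.2] -/
theorem neg_of_mem_moves_of_integrand_zero {n : ℕ} {r : KZ.IntegralRep n}
    (hr : EqOn r.integrand 0 r.domain) : -KZ.of r ∈ moves := by
  refine Or.inl (Or.inl (Or.inr ⟨n, r, r, r, rfl, rfl, ?_, by abel⟩))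
  intro x hx
  simp [hr hx]

/-- Two zero-integrand representations are joined by a chain of length `2`. [cite: KontsevichZagier2001, §1.2] -/
theorem chain_of_integrand_zero {n m : ℕ} {r : KZ.IntegralRep n} {r' : KZ.IntegralRep m}
    (hr : EqOn r.integrand 0 r.domain) (hr' : EqOn r'.integrand 0 r'.domain) :
    ∃ l : List KZ.FormalRep, l.length = 2 ∧ (∀ x ∈ l, x ∈ moves ∨ -x ∈ moves) ∧
      l.sum = KZ.of r - KZ.of r' := by
  refine ⟨[KZ.of r, -KZ.of r'], rfl, ?_, by simp [sub_eq_add_neg]⟩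
  intro x hx
  simp only [List.mem_cons, List.not_mem_nil, or_false] at hx
  rcases hx with rfl | rfl
  · exact Or.inr (neg_of_mem_moves_of_integrand_zero hr)
  · exact Or.inl (neg_of_mem_moves_of_integrand_zero hr')

/-- **`0 < a` is decorative.** With `a = 0` (everything else as in the crux) value equality forces
`b = 0`, and then a chain of length `2` joins `r` to `r'`. [folklore] -/
theorem chain_of_scalar_zero {A B A' B' : ℤ} (hΔ' : 4 * A' ^ 3 + 27 * B' ^ 2 ≠ 0) {b : ℚ}
    {r r' : KZ.IntegralRep 1}
    (h1 : r.domain = {x | 0 < x 0 ^ 3 + (A : ℝ) * x 0 + (B : ℝ)})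
    (h2 : EqOn r.integrand (fun x => ((0 : ℚ) : ℝ) / Real.sqrt (x 0 ^ 3 + (A : ℝ) * x 0 + (B : ℝ)))
      r.domain)
    (h3 : r'.domain = {x | 0 < x 0 ^ 3 + (A' : ℝ) * x 0 + (B' : ℝ)})
    (h4 : EqOn r'.integrand (fun x => (b : ℝ) / Real.sqrt (x 0 ^ 3 + (A' : ℝ) * x 0 + (B' : ℝ)))
      r'.domain)
    (h5 : r.value = r'.value) :
    b = 0 ∧ ∃ l : List KZ.FormalRep, l.length = 2 ∧ (∀ x ∈ l, x ∈ moves ∨ -x ∈ moves) ∧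
      l.sum = KZ.of r - KZ.of r' := by
  have hb : (b : ℝ) = 0 := by
    rw [value_eq_iff h1 h2 h3 h4] at h5
    simp only [Rat.cast_zero, zero_mul] at h5
    exact (mul_eq_zero.mp h5.symm).resolve_right (realPeriod_pos hΔ').ne'
  have hb' : b = 0 := by exact_mod_cast hb
  refine ⟨hb', chain_of_integrand_zero (fun x hx => ?_) (fun x hx => ?_)⟩
  · simp [h2 hx]
  · simp [h4 hx, hb]

/-- **Value equality is load-bearing**: without it the conclusion fails for EVERY bound `L`
(witness: the identity datum on `y² = x³ − x`, `a = 1`, `b = 2`; a chain would force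
`Ω = 2Ω`, contradicting `Ω > 0`, by soundness `KZ.Equivalent.value_eq_holds`). [folklore] -/
theorem not_chainBound_without_valueEq (L : ℤ → ℤ → ℤ → ℤ → ℝ) :
    ¬ ∀ (A B A' B' : ℤ), 4 * A ^ 3 + 27 * B ^ 2 ≠ 0 → 4 * A' ^ 3 + 27 * B' ^ 2 ≠ 0 →
      (∃ (f g : ℚ[X]) (c : ℚ), derivative f * g - f * derivative g ≠ 0 ∧
        C (c ^ 2) * g * (f ^ 3 + C (A' : ℚ) * f * g ^ 2 + C (B' : ℚ) * g ^ 3) =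
          (X ^ 3 + C (A : ℚ) * X + C (B : ℚ)) * (derivative f * g - f * derivative g) ^ 2) →
      ∀ (a b : ℚ), 0 < a → 0 < b → ∀ (r r' : KZ.IntegralRep 1),
        r.domain = {x | 0 < x 0 ^ 3 + (A : ℝ) * x 0 + (B : ℝ)} →
        EqOn r.integrand (fun x => (a : ℝ) / Real.sqrt (x 0 ^ 3 + (A : ℝ) * x 0 + (B : ℝ)))
          r.domain →
        r'.domain = {x | 0 < x 0 ^ 3 + (A' : ℝ) * x 0 + (B' : ℝ)} →
        EqOn r'.integrand (fun x => (b : ℝ) / Real.sqrt (x 0 ^ 3 + (A' : ℝ) * x 0 + (B' : ℝ)))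
          r'.domain →
        ∃ l : List KZ.FormalRep, (l.length : ℝ) ≤ L A B A' B' ∧
          (∀ x ∈ l, x ∈ moves ∨ -x ∈ moves) ∧ l.sum = KZ.of r - KZ.of r' := by
  intro H
  have hΔ : 4 * (-1 : ℤ) ^ 3 + 27 * (0 : ℤ) ^ 2 ≠ 0 := by norm_num
  obtain ⟨l, -, hmem, hsum⟩ := H (-1) 0 (-1) 0 hΔ hΔ ⟨X, 1, 1, identity_datum (-1) 0⟩ 1 2 one_pos
    two_pos (periodRep (-1) 0 1 hΔ) (periodRep (-1) 0 2 hΔ) rfl (fun _ _ => rfl) rfl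
    (fun _ _ => rfl)
  have hrel : KZ.of (periodRep (-1) 0 1 hΔ) - KZ.of (periodRep (-1) 0 2 hΔ) ∈ KZ.relations := by
    rw [← hsum]; exact sum_mem_relations_of_chain hmem
  have hval : (periodRep (-1) 0 1 hΔ).value = (periodRep (-1) 0 2 hΔ).value :=
    KZ.Equivalent.value_eq_holds hrel
  rw [periodRep_value, periodRep_value] at hval
  have hpos := realPeriod_pos hΔ
  push_cast at hval
  linarith


end Summit.KontsevichZagierPeriods.IsogenyCertificates.EffectiveXMapChainsNegative
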